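import Literature.Probability.RandomPlanarGeometry.HullRestrictionSLEHolds
import Literature.Probability.RandomPlanarGeometry.CaratheodoryHalfPlaneProofs
import Summits.CriticalPhenomena.SAWScalingLimit.Theorems.SAWRenewalTightnessSubseqIdentificationWindowTransport
import HarnessLib

/-!
# The SLE-side restriction identity HOLDS at `κ = 8/3` (line `boundary-area-law`, RS5 helper)

Line `boundary-area-law` of the crux `SubseqIdentification` (stmt-CriticalPhenomena-0783, route
`SAWRenewalTightness`; primary decl `SAWParafermion.SubseqIdentification`), restriction reshape
(lead c4): helper file for the SLE-side stub RS5 `stub_sleRestrictionRigidity`, which says that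
for `0 < κ ≤ 4`, `κ ≠ 8/3`, the two-sided restriction identity

  `μ'(T) · μ(N_r) = μ(T ∩ N_r)` for all Borel `T`,  `N_r = {c | r ≤ dist(x₀, trace c)}`,

between the chordal SLE_κ law `μ` of a Dobrushin domain `(D; a, b)` with a FLAT WINDOW
`D ∩ B(x₀, ρ₀) = {im z > im x₀} ∩ B(x₀, ρ₀)` (`ρ₀ ≤ dist(x₀, a), dist(x₀, b)`) and the SLE_κ law
`μ'` of the CARVED domain `D' = D ∖ B̄(x₀, r)` (`0 < r < ρ₀`, same marked points) FAILS.

This file proves the CONSISTENCY half in exactly the registered shape: **at `κ = 8/3` the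
identity HOLDS** (`sleRestrictionConsistency_eightThirds`). It is [LSW] Theorem 6.1
(restriction property of SLE_{8/3}) in the tree's transposed form
`IsSLELaw.hullRestriction_eightThirds_holds` (`μ'(T) · μ{Γ ⊆ cl D'} = μ(T ∩ {Γ ⊆ cl D'})` for a
hull subdomain `D'` of `D`), plus two pieces of window geometry proved here:

* `isHullSubdomain_of_carved` — the carved domain is a HULL SUBDOMAIN of `D`
  (`MarkedDomain.IsHullSubdomain`: `D' ⊆ D`, same marked points, and `cl(D ∖ D') ⊆ B̄(x₀, r)`
  misses `a`, `b` because `r < ρ₀ ≤ dist(x₀, a), dist(x₀, b)`);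
* `rangeSubset_closure_carved_eq` — the event dictionary
  `{Γ ⊆ cl D'} = N_r ∩ {Γ ⊆ cl D}`: `cl D' = cl D ∖ B(x₀, r)` (`closure_diff_closedBall_subset`,
  and conversely `closure_diff_ball_subset_closure_carved`: a point of `cl D` at distance `≥ r`
  from `x₀` is a limit of points of `D'` — off the sphere by openness of `ℂ ∖ B̄`, on the sphere
  `|z − x₀| = r` by pushing `z` radially outwards and upwards inside the window, where membership
  in `cl D` reads `im z ≥ im x₀`, `window_mem_iff`);

and the fact that `μ`-a.e. curve lies in `cl D` (`IsSLELaw.ae_endpoints` with Carathéodory's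
theorem `JordanDomain.mapsTo_boundaryExtension_holds`), so that `N_r = {Γ ⊆ cl D'}` `μ`-a.e.

References: G. F. Lawler, O. Schramm, W. Werner, *Conformal restriction: the chordal case*,
J. Amer. Math. Soc. 16 (2003), Thm. 6.1 with Prop. 3.3; Ch. Pommerenke, *Boundary Behaviour of
Conformal Maps* (1992), Thm. 2.1. No named fact is used.
-/

noncomputable section

open MeasureTheory Filter Topology Set Metric
open scoped NNReal ENNReal
open Literature.Probability.RandomPlanarGeometry

namespace Summit.CriticalPhenomena.SAWScalingLimit.Theorems.SubseqIdentification.BoundaryAreaLaw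

/-! ### The carved domain is a hull subdomain -/

/-- **The carved domain is a hull subdomain.** If `D' = D ∖ B̄(x₀, r)` has the same marked points
as `D` and `r < ρ₀ ≤ dist(x₀, a), dist(x₀, b)`, then `D'` is a hull subdomain of `D`
(`MarkedDomain.IsHullSubdomain`): the removed part lies in the closed ball, whose closure misses
both marked points. [folklore] -/
theorem isHullSubdomain_of_carved {D D' : DobrushinDomain} {x₀ : ℂ} {ρ₀ r : ℝ}
    (hrρ : r < ρ₀) (ha : ρ₀ ≤ dist x₀ (D.pt 0)) (hb : ρ₀ ≤ dist x₀ (D.pt 1))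
    (hD' : D'.carrier = D.carrier \ closedBall x₀ r) (h0 : D'.pt 0 = D.pt 0)
    (h1 : D'.pt 1 = D.pt 1) : D.IsHullSubdomain D' := by
  have hcl : closure (D.carrier \ D'.carrier) ⊆ closedBall x₀ r := by
    refine closure_minimal (fun z hz ↦ ?_) isClosed_closedBall
    by_contra h
    rw [hD'] at hz
    exact hz.2 ⟨hz.1, h⟩
  have hfar : ∀ i : Fin 2, ρ₀ ≤ dist x₀ (D.pt i) →
      D.pt i ∉ closure (D.carrier \ D'.carrier) := fun i hi h ↦ by
    have h' := hcl h
    rw [mem_closedBall, dist_comm] at h'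
    linarith
  refine ⟨?_, h0, h1, hfar 0 ha, hfar 1 hb⟩
  rw [hD']
  exact fun z hz ↦ hz.1

/-! ### Closure of the carved domain -/

/-- `cl(V ∖ B̄(x₀, r)) ⊆ cl V ∖ B(x₀, r)` (the open ball is open and misses `V ∖ B̄`). [folklore] -/
theorem closure_diff_closedBall_subset (V : Set ℂ) (x₀ : ℂ) (r : ℝ) :
    closure (V \ closedBall x₀ r) ⊆ closure V \ ball x₀ r := by
  intro z hz
  have hsub : V \ closedBall x₀ r ⊆ (ball x₀ r)ᶜ := fun w hw hwb ↦ hw.2 (ball_subset_closedBall hwb)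
  exact ⟨closure_mono (fun w hw ↦ hw.1) hz, closure_minimal hsub isOpen_ball.isClosed_compl hz⟩

/-- **Window geometry of the carved domain**: at a flat window
`V ∩ B(x₀, ρ₀) = {im z > im x₀} ∩ B(x₀, ρ₀)` (`V` open, `0 < r < ρ₀`), every point of `cl V` at
distance `≥ r` from `x₀` lies in `cl(V ∖ B̄(x₀, r))`. Off the sphere `|z − x₀| = r` this is the
openness of `ℂ ∖ B̄(x₀, r)`; on the sphere, `im z ≥ im x₀` (`window_mem_iff`) and the points
`z + t (z − x₀) + i t r`, `t ↓ 0`, lie in the open upper half of the window ball, off `B̄(x₀, r)`,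
and tend to `z`. [folklore] -/
theorem closure_diff_ball_subset_closure_carved {V : Set ℂ} (hV : IsOpen V) {x₀ : ℂ} {ρ₀ r : ℝ}
    (hr : 0 < r) (hrρ : r < ρ₀)
    (hwin : V ∩ ball x₀ ρ₀ = {z : ℂ | x₀.im < z.im} ∩ ball x₀ ρ₀) :
    closure V \ ball x₀ r ⊆ closure (V \ closedBall x₀ r) := by
  rintro z ⟨hzV, hzb⟩
  rw [mem_ball, not_lt] at hzb
  rcases hzb.lt_or_eq with hlt | heq
  · -- off the sphere
    have hz : z ∈ (closedBall x₀ r)ᶜ := by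
      rw [mem_compl_iff, mem_closedBall, not_le]
      exact hlt
    have h := isClosed_closedBall.isOpen_compl.inter_closure ⟨hz, hzV⟩
    rwa [← sdiff_eq_compl_inter] at h
  · -- on the sphere: `dist z x₀ = r`, `im x₀ ≤ im z`
    have hzball : z ∈ ball x₀ ρ₀ := by
      rw [mem_ball, ← heq]
      exact hrρ
    have him : x₀.im ≤ z.im := ((window_mem_iff hV hwin hzball).2.1).1 hzV
    set v : ℂ := z - x₀ with hv
    have hvn : ‖v‖ = r := by rw [hv, ← dist_eq_norm, ← heq]
    have hvre : v.re ^ 2 + v.im ^ 2 = r ^ 2 := by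
      rw [← hvn, Complex.sq_norm, Complex.normSq_apply]
      ring
    have hvim : 0 ≤ v.im := by
      rw [hv, Complex.sub_im]
      linarith
    rw [Metric.mem_closure_iff]
    intro ε hε
    -- the parameter `t`
    obtain ⟨t, ht0, htε, htρ⟩ : ∃ t : ℝ, 0 < t ∧ 2 * t * r < ε ∧ r + 2 * t * r < ρ₀ := by
      refine ⟨min (ε / (4 * r)) ((ρ₀ - r) / (4 * r)), lt_min (by positivity) ?_, ?_, ?_⟩
      · exact div_pos (by linarith) (by positivity)
      · have h1 : min (ε / (4 * r)) ((ρ₀ - r) / (4 * r)) ≤ ε / (4 * r) := min_le_left _ _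
        have h2 : 2 * (ε / (4 * r)) * r = ε / 2 := by field_simp; ring
        nlinarith
      · have h1 : min (ε / (4 * r)) ((ρ₀ - r) / (4 * r)) ≤ (ρ₀ - r) / (4 * r) := min_le_right _ _
        have h2 : 2 * ((ρ₀ - r) / (4 * r)) * r = (ρ₀ - r) / 2 := by field_simp; ring
        nlinarith
    -- the point `w = z + t v + i t r`
    set w : ℂ := z + (t : ℂ) * v + Complex.I * ((t * r : ℝ) : ℂ) with hw
    have hwx : w - x₀ = ((1 + t : ℝ) : ℂ) * v + Complex.I * ((t * r : ℝ) : ℂ) := by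
      rw [hw, hv]
      push_cast
      ring
    have hwz : w - z = (t : ℂ) * v + Complex.I * ((t * r : ℝ) : ℂ) := by
      rw [hw]
      ring
    -- norms
    have hn1 : ‖((1 + t : ℝ) : ℂ) * v‖ = (1 + t) * r := by
      rw [norm_mul, Complex.norm_of_nonneg (by linarith), hvn]
    have hn2 : ‖Complex.I * ((t * r : ℝ) : ℂ)‖ = t * r := by
      rw [norm_mul, Complex.norm_I, one_mul, Complex.norm_of_nonneg (by positivity)]
    have hn3 : ‖(t : ℂ) * v‖ = t * r := by
      rw [norm_mul, Complex.norm_of_nonneg ht0.le, hvn]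
    have hdist_wx_le : dist w x₀ ≤ (1 + t) * r + t * r := by
      rw [dist_eq_norm, hwx]
      exact (norm_add_le _ _).trans (by rw [hn1, hn2])
    have hdist_wz : dist z w < ε := by
      rw [dist_comm, dist_eq_norm, hwz]
      refine (norm_add_le _ _).trans_lt ?_
      rw [hn3, hn2]
      linarith
    have hdist_wx_gt : r < dist w x₀ := by
      rw [dist_eq_norm, hwx]
      refine lt_of_pow_lt_pow_left₀ 2 (norm_nonneg _) ?_
      have hre : (((1 + t : ℝ) : ℂ) * v + Complex.I * ((t * r : ℝ) : ℂ)).re = (1 + t) * v.re := by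
        simp [Complex.add_re, Complex.mul_re, Complex.ofReal_re, Complex.ofReal_im,
          Complex.I_re, Complex.I_im]
      have him' : (((1 + t : ℝ) : ℂ) * v + Complex.I * ((t * r : ℝ) : ℂ)).im =
          (1 + t) * v.im + t * r := by
        simp [Complex.add_im, Complex.mul_im, Complex.ofReal_re, Complex.ofReal_im,
          Complex.I_re, Complex.I_im]
      rw [Complex.sq_norm, Complex.normSq_apply, hre, him']
      have h1 : (1 + t) * v.re * ((1 + t) * v.re) + ((1 + t) * v.im + t * r) * ((1 + t) * v.im + t * r) =
          (1 + t) ^ 2 * r ^ 2 + 2 * (1 + t) * t * r * v.im + t ^ 2 * r ^ 2 := by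
        linear_combination (1 + t) ^ 2 * hvre
      have h2 : 0 ≤ 2 * (1 + t) * t * r * v.im := mul_nonneg (by positivity) hvim
      have h3 : r ^ 2 < (1 + t) ^ 2 * r ^ 2 := by nlinarith [mul_pos ht0 hr, mul_pos hr hr]
      rw [h1]
      nlinarith [sq_nonneg (t * r)]
    -- `w ∈ V ∖ B̄(x₀, r)`
    have hwim : x₀.im < w.im := by
      have h : w.im = z.im + t * v.im + t * r := by
        rw [hw]
        simp [Complex.add_im, Complex.mul_im, Complex.ofReal_re, Complex.ofReal_im,
          Complex.I_re, Complex.I_im]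
      rw [h]
      nlinarith [mul_nonneg ht0.le hvim, mul_pos ht0 hr]
    have hwball : w ∈ ball x₀ ρ₀ := by
      rw [mem_ball]
      linarith
    have hwV : w ∈ V := by
      have h : w ∈ {z : ℂ | x₀.im < z.im} ∩ ball x₀ ρ₀ := ⟨hwim, hwball⟩
      rw [← hwin] at h
      exact h.1
    refine ⟨w, ⟨hwV, fun h ↦ ?_⟩, hdist_wz⟩
    rw [mem_closedBall] at h
    linarith

/-- **The event dictionary.** At a flat window and for the carved domain `D' = D ∖ B̄(x₀, r)`
(`0 < r < ρ₀`): a curve class lies in `cl D'` iff it lies in `cl D` and stays at distance `≥ r`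
from `x₀` — `{Γ ⊆ cl D'} = {r ≤ dist(x₀, trace)} ∩ {Γ ⊆ cl D}`. [folklore] -/
theorem rangeSubset_closure_carved_eq {D D' : DobrushinDomain} {x₀ : ℂ} {ρ₀ r : ℝ}
    (hr : 0 < r) (hrρ : r < ρ₀)
    (hwin : D.carrier ∩ ball x₀ ρ₀ = {z : ℂ | x₀.im < z.im} ∩ ball x₀ ρ₀)
    (hD' : D'.carrier = D.carrier \ closedBall x₀ r) :
    CurveClass.rangeSubset (closure D'.carrier) =
      {c : CurveClass ℂ | r ≤ infDist x₀ c.range} ∩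
        CurveClass.rangeSubset (closure D.carrier) := by
  ext c
  simp only [CurveClass.mem_rangeSubset, mem_inter_iff, mem_setOf_eq]
  rw [hD']
  constructor
  · intro h
    have h' : c.range ⊆ closure D.carrier \ ball x₀ r :=
      h.trans (closure_diff_closedBall_subset _ _ _)
    refine ⟨(le_infDist c.range_nonempty).2 fun z hz ↦ ?_, fun z hz ↦ (h' hz).1⟩
    have h'' := (h' hz).2
    rw [mem_ball, not_lt, dist_comm] at h''
    exact h''
  · rintro ⟨hdist, hcl⟩
    have h' : c.range ⊆ closure D.carrier \ ball x₀ r := fun z hz ↦ by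
      refine ⟨hcl hz, ?_⟩
      rw [mem_ball, not_lt, dist_comm]
      exact (le_infDist c.range_nonempty).1 hdist hz
    exact h'.trans (closure_diff_ball_subset_closure_carved D.isOpen hr hrρ hwin)

/-! ### Consistency at `κ = 8/3` -/

/-- **RS5 consistency — the restriction identity HOLDS for the chordal SLE_{8/3} laws of `(D, D')`
in exactly the registered shape of `stub_sleRestrictionRigidity`.** For a Dobrushin domain
`(D; a, b)` with a flat window at `x₀` whose closed ball of radius `ρ₀` misses `a`, `b`, the carved
domain `D' = D ∖ B̄(x₀, r)` (`0 < r < ρ₀`, same marked points) and the chordal SLE_{8/3} laws `μ` of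
`D` and `μ'` of `D'`: `μ'(T) · μ{r ≤ dist(x₀, trace)} = μ(T ∩ {r ≤ dist(x₀, trace)})` for every
Borel `T`. This is [LSW] Thm. 6.1 transposed (`IsSLELaw.hullRestriction_eightThirds_holds`) for the
hull subdomain `D'` (`isHullSubdomain_of_carved`), the event `{Γ ⊆ cl D'}` being `μ`-a.e. equal to
`{r ≤ dist(x₀, trace)}` (`rangeSubset_closure_carved_eq`, and `Γ ⊆ cl D` a.s. by
`IsSLELaw.ae_endpoints` with Carathéodory). So the exponent `κ = 8/3` is NOT excluded by the
restriction pin, as it must not be. [cite: LawlerSchrammWerner2003Restriction, Thm. 6.1 with Prop. 3.3] -/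
theorem sleRestrictionConsistency_eightThirds :
    ∀ (D D' : DobrushinDomain) (μ μ' : Measure (CurveClass ℂ)) (x₀ : ℂ) (ρ₀ r : ℝ),
      0 < r → r < ρ₀ →
      D.carrier ∩ Metric.ball x₀ ρ₀ = {z : ℂ | x₀.im < z.im} ∩ Metric.ball x₀ ρ₀ →
      ρ₀ ≤ dist x₀ (D.pt 0) → ρ₀ ≤ dist x₀ (D.pt 1) →
      D'.carrier = D.carrier \ Metric.closedBall x₀ r → D'.pt 0 = D.pt 0 → D'.pt 1 = D.pt 1 →
      IsSLELaw (8 / 3) D μ → IsSLELaw (8 / 3) D' μ' →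
      ∀ T : Set (CurveClass ℂ), MeasurableSet T →
        μ' T * μ {c | r ≤ Metric.infDist x₀ c.range} =
          μ (T ∩ {c | r ≤ Metric.infDist x₀ c.range}) := by
  intro D D' μ μ' x₀ ρ₀ r hr hrρ hwin ha hb hD' h0 h1 hμ hμ' T hT
  have hsub : D.IsHullSubdomain D' := isHullSubdomain_of_carved hrρ ha hb hD' h0 h1
  have hV := rangeSubset_closure_carved_eq (D := D) (D' := D') hr hrρ hwin hD'
  have hae : ∀ᵐ c ∂μ, c ∈ CurveClass.rangeSubset (closure D.carrier) :=
    (hμ.ae_endpoints JordanDomain.mapsTo_boundaryExtension_holds).mono fun c hc ↦ hc.2.2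
  have hNV : ({c : CurveClass ℂ | r ≤ infDist x₀ c.range} : Set (CurveClass ℂ)) =ᵐ[μ]
      CurveClass.rangeSubset (closure D'.carrier) := by
    rw [hV]
    exact Filter.eventuallyEq_set.2 (hae.mono fun c hc ↦ ⟨fun h ↦ ⟨h, hc⟩, fun h ↦ h.1⟩)
  have hTNV : (T ∩ {c : CurveClass ℂ | r ≤ infDist x₀ c.range} : Set (CurveClass ℂ)) =ᵐ[μ]
      (T ∩ CurveClass.rangeSubset (closure D'.carrier) : Set (CurveClass ℂ)) :=
    (ae_eq_refl T).inter hNV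
  rw [measure_congr hNV, measure_congr hTNV]
  exact IsSLELaw.hullRestriction_eightThirds_apply hμ hμ' hsub hT

end Summit.CriticalPhenomena.SAWScalingLimit.Theorems.SubseqIdentification.BoundaryAreaLaw

end
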